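import Summits.BirchSwinnertonDyer.Rank1Residual.X11a.ChainBoundedHeightFree
import Literature.NumberTheory.EllipticCurves.HidaFamilyMembersMultiplicativeProofs
import Literature.NumberTheory.EllipticCurves.AnalyticRankModularityProofs
import Literature.NumberTheory.EllipticCurves.ModularParametrizationTrustBaseProofs
import Literature.NumberTheory.EllipticCurves.ModularParametrizationDegreeHoldsProofs
import HarnessLib

/-!
# Class X11a: the chain of record at ANY tame level — the Hida-family existence fact RETIRED and
# modularity counted ONCE (cell `b2b-bsdres`, unit `b2b-bsdres-x11a`, gen 20; sized ask S-g19-1, phase 2)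

HONEST FRAMING (run/shared/lean/b2b/bsd-rank1-residual/, verbatim in every file): the goal of the
cell is to DELETE the COMBINATION-SHAPED residual classes of the Birch–Swinnerton-Dyer formula for
ALL analytic-rank `≤ 1` elliptic curves over `ℚ` — "full BSD formula for every rank `≤ 1` curve in
class `C`" assembled STRICTLY from published theorems — so that the rank-`≤ 1` remainder becomes
exactly the CONSTRUCTION-SHAPED classes, which are TYPED (missing-input `Prop`s), NOT attempted.
This is not "finishing BSD". Research route; NO CLAIM BEYOND STATED CLASSES. Theorems only; every
published input is an explicit NAMED-FACT hypothesis; no new definition, no new fact.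

WHAT. The chain of record `X11a.forall_bsdp_of_namedFacts_bdd_mtt_heightFree`
(`X11a/ChainBoundedHeightFree.lean`; on X11a ∩ {`p ≥ 5`, `ρ̄_{E,p}` surjective},
`MuAnZeroAt W p ⟹ BSD(E,p)` from 14 named published facts) binds
(a) `hHida : hida_exists_congruent_ordinary_newform_of_multiplicative` (registry A77; Hida 1986 /
EPW Thm. 2.1.2–2.2.2): a good-ordinary weight-`k` member of `H(E[p])` of level EXACTLY `N/p`; and
(b) modularity THREE times: `hmod : hasEntireLFunction_rat`, `hpar : nonempty_modularParametrizationData`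
and — once A77's classical layer is taken from `exists_isNewform0_dvd_conductorNorm_div_congr_of_
multiplicative_of_exists_isNewformOf` (gen 19, `HidaFamilyMembersMultiplicativeProofs.lean`) —
`hNf : exists_isNewformOf`.
(a) The member delivered by modularity has SOME level `M′ ∣ N/p` (Deligne–Serre lift keeping `U_p`,
then `p`-old descent); EPW's family `H(ρ̄)` consists of the members of EVERY tame level prime to `p`
(arXiv:math/0404484 p. 2; Thm. 2 compares members of different tame levels) and Wan 2015 Thm. 4
needs only `p ∤ M`, so the four member facts were re-typed by the literature seat at ANY level `M`
with `p ∤ M` (`IsOrdinaryMemberOfLevel`; `thm311_cotorsion_weightK_member_ofLevel`,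
`thm1_muAlg_of_weightK_member_ofLevel`, `thm513_transfer_from_weightK_member_of_bdd_ofLevel`,
`Wan2015.thm4_rational_weightK_member_of_bdd_ofLevel` — statements otherwise byte-identical; each
old instance follows from its twin at `M := N/p`). With them the chain consumes the
modularity-built member and A77 has no binder left.
(b) `hasEntireLFunction_rat` and `nonempty_modularParametrizationData` are tree THEOREMS granted
`exists_isNewformOf` (`hasEntireLFunction_rat_of_exists_isNewformOf`, and
`nonempty_modularParametrizationData_of_exists_isNewformOf` + `exists_maninConstant_ne_zero_holds`).

RESULT (`X11a.forall_bsdp_of_namedFacts_ofLevel_heightFree`): **on ALL of X11a ∩ {`p ≥ 5`,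
`ρ̄_{E,p}` surjective}: `MuAnZeroAt W p ⟹ BSD(E,p)` from 12 NAMED PUBLISHED FACTS + the per-pair
certificate** — EPW 2006 Thm 3.1.1 / Thm 1 / Thm 5.1.3-bounded (any level), Wan 2015 Thm 4
rational-bounded (any level), Deligne–Serre 6.1, Hida/Wiles 3.26, Kato–Wuthrich A32, Stein–Wuthrich
2013 Thm 6.1 split / non-split, Gross–Zagier–Kolyvagin, modularity (`exists_isNewformOf`),
Greenberg–Stevens; 10 at a non-split prime (`…_of_nonsplit`), 11 at a split prime (`…_of_split`);
13 with BDMTV and NO image hypothesis at `p ≥ 11` (`…_of_eleven_le`); 12 with no image hypothesis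
when `p ∤ ord_p(Δ_min)` (`…_of_not_dvd`). None of the 12 is a Hida-family existence statement.
Class-level residue UNCHANGED: Greenberg's `μ`-conjecture (typed `X11a.MuAnZeroAt`). No label
change by this file (cell lead / referee).

References: [EmertonPollackWeston2006] p. 2, Thm. 1, 2, 3.1.1, 4.4.5, 5.1.3, §2.1, Ex. 5.3.1;
[Wan2015] Thm. 4 = Thm. 103; [BreuilConradDiamondTaylor2001] Thm. A, p. 845 (2) ⇒ (6);
[SteinWuthrich2013] Thm. 6.1; HOME/b2b-bsdres-x11a/REPORT-g20.md, X11A-CHAIN.md §11.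
-/

noncomputable section

open scoped Classical MatrixGroups ModularForm

open CongruenceSubgroup WeierstrassCurve Literature.NumberTheory.EllipticCurves
  Literature.NumberTheory.EllipticCurves.ModularForms
  Literature.NumberTheory.EllipticCurves.Rank1Residual
  Literature.NumberTheory.EllipticCurves.Rank1Residual.Typed
  Literature.NumberTheory.EllipticCurves.Wuthrich2014
  Literature.NumberTheory.EllipticCurves.SteinWuthrich2013
  Literature.NumberTheory.EllipticCurves.GreenbergVatsal2000
  Literature.NumberTheory.EllipticCurves.EmertonPollackWeston2006
  Literature.NumberTheory.EllipticCurves.BalakrishnanEtAl2019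
  Summit.BirchSwinnertonDyer.Rank1Residual.X1.MuLambda
  Summit.BirchSwinnertonDyer.Rank1Residual.X11a.LambdaNorm
  Summit.BirchSwinnertonDyer.Rank1Residual.RankZeroHeightFree

set_option autoImplicit false

namespace Summit.BirchSwinnertonDyer.Rank1Residual.X11a.Chain

/-! ### The pair-level chain with a member of ANY tame level prime to `p` -/

section MemberOfLevel

variable (W : WeierstrassCurve ℚ) [W.IsElliptic] [W.IsGloballyMinimal] (p : ℕ) [Fact p.Prime]

/-- **The chain at a pair on the level-generic (bounded) Wan / EPW facts, the Hida-family member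
supplied AT THE PAIR at ANY tame level prime to `p`** (`hMemW`: for every admissible weight `k`
some level `M` with `p ∤ M`, a newform `g ∈ S_k(Γ₀(M))` and `ι` with `IsOrdinaryMemberOfLevel W p g ι`
— e.g. the modularity-built member of level `M′ ∣ N/p`, see
`invariantsAt_normLam_of_modularity_ofLevel`). Same proof as harvest-2's
`invariantsAt_normLam_of_facts_bdd` / gen 19's `invariantsAt_normLam_of_member_bdd` with the level
freed; the existence inputs (E1)–(E3) are the level-generic tree theorems
`OrdinaryPadicData.nonempty_of_thm61_of_thm326` (granted Deligne–Serre 6.1 `h61` and Hida/Wiles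
3.26 `h326`), `GreenbergSelmer.nonempty_dualData`, `GreenbergSelmer.DualData.isPrincipal_charIdeal`;
the MTT existence fact is the tree theorem `exists_isCycPAdicLFunctionWeightK_holds` (its
BOUNDEDNESS clause kept and fed to the `_of_bdd` facts); `nonempty_modularParametrizationData`
(`hpar`, needed by the certificate step [L4]) stays a binder here and is discharged from
`exists_isNewformOf` downstream. Conclusion: every Kato pair has unit contents and
`normLam gK = normLam fE`. [cite: EmertonPollackWeston2006, p. 2 (H(ρ̄)), Thm. 1, Thm. 3.1.1, Thm. 5.1.3]
[cite: Wan2015, Thm. 4 (pp. 4–5) = Thm. 103 (pp. 91–92)] -/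
theorem invariantsAt_normLam_of_memberOfLevel_bdd
    (hMemW : ∀ (k : ℤ), 2 < k → ((p : ℤ) - 1) ∣ (k - 2) →
      ∃ (M : ℕ) (_ : NeZero M) (_ : ¬ p ∣ M) (g : CuspForm (Gamma0 M) k)
        (ι : coeffField g →+* PadicAlgCl p), IsOrdinaryMemberOfLevel W p g ι)
    (h311 : thm311_cotorsion_weightK_member_ofLevel) (hT1a : thm1_muAlg_of_weightK_member_ofLevel)
    (hT2 : Wan2015.thm4_rational_weightK_member_of_bdd_ofLevel)
    (hT1b : thm513_transfer_from_weightK_member_of_bdd_ofLevel)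
    (h61 : DeligneSerre1974.thm61_exists_adicGaloisRep) (h326 : Hida2000_thm326_ordinary)
    (hKato : kato_charIdeal_dvd_multiplicative_of_surjective)
    (hpar : nonempty_modularParametrizationData)
    (hp : 5 ≤ p) (hmult : W.HasMultiplicativeReductionAtPrime p)
    (hsurj : W.HasSurjectiveModNGaloisRep p) (hμ : MuAnZeroAt W p) :
    InvariantsAt W p fun gK fE => HasUnitContent gK ∧ HasUnitContent fE ∧ normLam gK = normLam fE := by
  -- adapted from `invariantsAt_normLam_of_facts_bdd` (X11a/ChainBounded.lean, harvest-2 gen 24)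
  have hprime : p.Prime := Fact.out
  have hp2 : p ≠ 2 := by omega
  haveI : NeZero p := ⟨hprime.ne_zero⟩
  have hirr : W.HasIrreducibleModPGaloisRep p :=
    hasIrreducibleModPGaloisRep_of_hasSurjectiveModNGaloisRep W p hsurj
  -- [L1]: the weight-`k` member, `k = (p − 1) + 2`, at its own level `M`, `p ∤ M`
  set n : ℕ := p - 1 with hn
  have hn0 : n ≠ 0 := by omega
  have hneven : Even n := hn ▸ hprime.even_sub_one hp2
  have hk2 : (2 : ℤ) < (n : ℤ) + 2 := by omega
  have hkdvd : ((p : ℤ) - 1) ∣ ((n : ℤ) + 2 - 2) := by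
    refine ⟨1, ?_⟩
    rw [hn, Nat.cast_sub hprime.one_le]; push_cast; ring
  obtain ⟨M, _instM, hpM, g, ι, hmem⟩ := hMemW ((n : ℤ) + 2) hk2 hkdvd
  have hg : IsNewform0 g := hmem.2.2.1
  -- (E1) the ordinary `p`-adic data (Deligne–Serre 6.1 + Hida/Wiles 3.26); Shimura's datum;
  -- THE `p`-adic `L`-function with its BOUNDEDNESS clause
  obtain ⟨𝔇⟩ := OrdinaryPadicData.nonempty_of_thm61_of_thm326 h61 h326 g hg (by omega) p hpM ι
    hmem.2.2.2.1
  obtain ⟨Dsym⟩ := IsNewform0.nonempty_periodSymbolDatum hneven hn0 hg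
  obtain ⟨L, hL, hbd, -⟩ :=
    exists_isCycPAdicLFunctionWeightK_holds g hg (by omega) p hpM ι 𝔇.υ 𝔇.υ_root 𝔇.norm_υ Dsym
  -- [L4]: `μ(X(E/ℚ_∞)) = 0` for every cyclotomic / dual datum, from the certificate
  have hμalg : ∀ (κ : ZpExtension ℚ p) (γ : Field.absoluteGaloisGroup ℚ), κ.IsCyclotomic →
      κ.IsTopGenerator γ → IsCyclotomicVariable p γ →
      ∀ D' : W.SelmerDualData κ γ, D'.IsTorsion ∧ D'.mu = 0 :=
    fun κ γ hκ hγ hγ' D' =>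
      ⟨(isTorsion_and_exists_generator_hasUnitContent_of_muAnZeroAt W p hKato hpar hp hmult hsurj hμ
          hκ hγ hγ' D').1,
        selmerDual_mu_eq_zero_of_muAnZeroAt W p hKato hpar hp hmult hsurj hμ hκ hγ hγ' D'⟩
  -- the conclusion's own cyclotomic datum serves the `g`-side
  intro κ γ hκ hγ hγ' N _ f hf D' ϖ hϖ fE gK hchar
  -- (E2) the dual datum; EPW Thm. 3.1.1 (cotorsion); (E3) a principal generator
  obtain ⟨D⟩ := GreenbergSelmer.nonempty_dualData (memberGenerators g ι 𝔇.υ) κ hγ 𝔇.ρ 𝔇.plus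
  obtain ⟨hfin, htors⟩ := h311 W p hp hmult hirr hpM g ι hmem 𝔇 κ γ hκ hγ D
  haveI : FiniteDimensional ℚ_[p] (padicCoeffField (memberGenerators g ι 𝔇.υ)) :=
    finiteDimensional_padicCoeffField_memberGenerators hg ι 𝔇.υ
  obtain ⟨G, hG⟩ :=
    (GreenbergSelmer.DualData.isPrincipal_charIdeal (memberGenerators g ι 𝔇.υ) D).principal
  -- EPW Thm. 1 (alg): `μ^alg(g) = 0`
  have hμg := hT1a W p hp hmult hirr hμalg hpM g ι hmem 𝔇 κ γ hκ hγ hγ' D htors G hG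
  -- Wan Thm. 4: `L = c · u · G`, hence `λ^alg(g) = λ^an(g)`
  obtain ⟨c, u, hc, hLcuG⟩ :=
    hT2 W p hp hmult hsurj hpM g ι hmem 𝔇 κ γ hκ hγ hγ' D htors G hG Dsym L hL hbd
  have hlam : normLam (PowerSeries.map (padicCoeffIntegers (memberGenerators g ι 𝔇.υ)).subtype G) =
      normLam L := by
    obtain ⟨hU0, hU⟩ := map_unit_integral u
    obtain ⟨hGmax, hG0⟩ := hasMaxCoeff_map_of_exists_norm_eq_one hμg
    rw [hLcuG, normLam_C_mul (norm_ne_zero_iff.mpr hc), map_mul,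
      normLam_mul_of_integral_unit hU0 hU hGmax hG0]
  -- EPW Thm. 5.1.3 (+ 4.4.5 with the certificate), at the Kato pair
  exact hT1b W p hp hmult hirr hpM g ι hmem 𝔇 κ γ hκ hγ hγ' D htors G hG Dsym L hL hbd hμg hlam hμ κ
    γ hκ hγ hγ' f hf D' ϖ hϖ fE gK hchar

/-- **The Hida-family member from the Modularity Theorem, at any admissible weight, as a
level-generic member**: for `W/ℚ` globally minimal, `p ≥ 5` multiplicative, `k > 2` with
`k ≡ 2 (mod p − 1)`, the newform `g ∈ S_k(Γ₀(M′))`, `M′ ∣ N/p`, of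
`exists_isNewform0_dvd_conductorNorm_div_congr_of_multiplicative_of_exists_isNewformOf hNf`
(Deligne–Serre lift of `f_E · E_{k−2}` keeping `U_p`, then `p`-old descent) satisfies
`IsOrdinaryMemberOfLevel W p g ι`, and `p ∤ M′` (`p ‖ N`). This is the conclusion of the retired
fact A77 with the level freed — no Hida-family existence statement is used.
[cite: EmertonPollackWeston2006, p. 2 (H(ρ̄)) and §2.1, Thm. 2.1.2 (arXiv:math/0404484 pp. 2, 7)]
[cite: DeligneSerreASENS1974, 6.9–6.11] [cite: BreuilConradDiamondTaylor2001, Thm. A] -/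
theorem exists_memberOfLevel_of_exists_isNewformOf (hNf : exists_isNewformOf) (hp : 5 ≤ p)
    (hmult : W.HasMultiplicativeReductionAtPrime p) (k : ℤ) (hk : 2 < k)
    (hpk : ((p : ℤ) - 1) ∣ (k - 2)) :
    ∃ (M : ℕ) (_ : NeZero M) (_ : ¬ p ∣ M) (g : CuspForm (Gamma0 M) k)
      (ι : coeffField g →+* PadicAlgCl p), IsOrdinaryMemberOfLevel W p g ι := by
  obtain ⟨M, instM, hM, g, ι, hg, hap, hcong⟩ :=
    exists_isNewform0_dvd_conductorNorm_div_congr_of_multiplicative_of_exists_isNewformOf hNf W p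
      hp hmult k hk hpk
  refine ⟨M, instM, fun h => not_dvd_conductorNorm_div W p hmult (h.trans hM), g, ι,
    hk, hpk, hg, hap, fun ℓ hℓ hℓNM => hcong ℓ hℓ fun h => hℓNM (dvd_mul_of_dvd_left h M)⟩

/-- **The chain at a pair with NO Hida-family existence fact and modularity counted once**: the
member comes from `exists_isNewformOf` (`exists_memberOfLevel_of_exists_isNewformOf`), and so
does `nonempty_modularParametrizationData` (`nonempty_modularParametrizationData_of_exists_isNewformOf`
with the tree theorem `IsNewformOf.exists_maninConstant_ne_zero_holds`).
[cite: EmertonPollackWeston2006, Thm. 1, Thm. 3.1.1, Thm. 5.1.3] [cite: Wan2015, Thm. 4]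
[cite: BreuilConradDiamondTaylor2001, Thm. A and p. 845 (2) ⇒ (6)] -/
theorem invariantsAt_normLam_of_modularity_ofLevel (hNf : exists_isNewformOf)
    (h311 : thm311_cotorsion_weightK_member_ofLevel) (hT1a : thm1_muAlg_of_weightK_member_ofLevel)
    (hT2 : Wan2015.thm4_rational_weightK_member_of_bdd_ofLevel)
    (hT1b : thm513_transfer_from_weightK_member_of_bdd_ofLevel)
    (h61 : DeligneSerre1974.thm61_exists_adicGaloisRep) (h326 : Hida2000_thm326_ordinary)
    (hKato : kato_charIdeal_dvd_multiplicative_of_surjective)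
    (hp : 5 ≤ p) (hmult : W.HasMultiplicativeReductionAtPrime p)
    (hsurj : W.HasSurjectiveModNGaloisRep p) (hμ : MuAnZeroAt W p) :
    InvariantsAt W p fun gK fE => HasUnitContent gK ∧ HasUnitContent fE ∧ normLam gK = normLam fE :=
  invariantsAt_normLam_of_memberOfLevel_bdd W p
    (exists_memberOfLevel_of_exists_isNewformOf W p hNf hp hmult) h311 hT1a hT2 hT1b h61 h326 hKato
    (nonempty_modularParametrizationData_of_exists_isNewformOf hNf
      IsNewformOf.exists_maninConstant_ne_zero_holds)
    hp hmult hsurj hμ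

/-- **`BSD(E,p)` AT A PAIR from the 12 named facts + the certificate, with no class predicate**:
`W/ℚ` globally minimal, `p ≥ 5` multiplicative, `ρ̄_{E,p}` surjective, `r_an(E) = 0`, `μ^an(E,p) = 0`
⟹ `BSD(E,p)` (the `(ram)` / irreducibility atoms of `ClassX11a` are not used by the chain; only
`r_an = 0`, `p ‖ N`, surjectivity and the certificate). Height-free socket
`bsdp_of_invariantsMatchAt_heightFree`; modularity once (`hNf`).
[cite: EmertonPollackWeston2006, Thm. 1, Thm. 3.1.1, Thm. 5.1.3] [cite: Wan2015, Thm. 4]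
[cite: SteinWuthrich2013, Thm. 6.1 (p. 20)] [cite: BreuilConradDiamondTaylor2001, Thm. A and p. 845 (2) ⇒ (6)] -/
theorem bsdp_of_modularity_ofLevel (hNf : exists_isNewformOf)
    (h311 : thm311_cotorsion_weightK_member_ofLevel) (hT1a : thm1_muAlg_of_weightK_member_ofLevel)
    (hT2 : Wan2015.thm4_rational_weightK_member_of_bdd_ofLevel)
    (hT1b : thm513_transfer_from_weightK_member_of_bdd_ofLevel)
    (h61 : DeligneSerre1974.thm61_exists_adicGaloisRep) (h326 : Hida2000_thm326_ordinary)
    (hKato : kato_charIdeal_dvd_multiplicative_of_surjective)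
    (hJs : thm61_splitMultiplicative) (hJn : thm61_nonsplitMultiplicative)
    (hGZK : rank_eq_analyticRank_of_analyticRank_le_one)
    (hGS : greenberg_stevens (W := W) (p := p))
    (hp : 5 ≤ p) (hmult : W.HasMultiplicativeReductionAtPrime p)
    (hsurj : W.HasSurjectiveModNGaloisRep p) (hr : W.analyticRank = 0) (hμ : MuAnZeroAt W p) :
    BSDp W p :=
  bsdp_of_invariantsMatchAt_heightFree W p hKato hJs hJn hGZK
    (hasEntireLFunction_rat_of_exists_isNewformOf hNf)
    (nonempty_modularParametrizationData_of_exists_isNewformOf hNf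
      IsNewformOf.exists_maninConstant_ne_zero_holds)
    hGS hp hmult hsurj hr
    (invariantsMatchAt_of_invariantsAt_normLam W p
      (invariantsAt_normLam_of_modularity_ofLevel W p hNf h311 hT1a hT2 hT1b h61 h326 hKato hp hmult
        hsurj hμ))

end MemberOfLevel

end Summit.BirchSwinnertonDyer.Rank1Residual.X11a.Chain

/-! ### Class level: ALL of X11a, 12 named facts -/

namespace Summit.BirchSwinnertonDyer.Rank1Residual.X11a

open Chain

/-- **THE CHAIN OF RECORD (gen 20) — X11a ∩ {`p ≥ 5`, `ρ̄_{E,p}` surjective}: `BSD(E,p)` ⇐ 12 NAMED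
PUBLISHED FACTS + the per-pair certificate `μ^an(E,p) = 0`, NONE of the 12 a Hida-family existence
statement, modularity counted ONCE.** The 12: EPW 2006 Thm 3.1.1 / Thm 1 / Thm 5.1.3-bounded at any
tame level (`h311`, `hT1a`, `hT1b`), Wan 2015 Thm 4 rational-bounded at any tame level (`hT2`),
Deligne–Serre 6.1 (`h61`), Hida/Wiles 3.26 (`h326`), Kato–Wuthrich A32 (`hKato`), Stein–Wuthrich
2013 Thm 6.1 split / non-split (`hJs`, `hJn`), Gross–Zagier–Kolyvagin (`hGZK`), modularity
(`hNf : exists_isNewformOf`, BCDT Thm. A — supplying the Hida-family member through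
`exists_isNewform0_dvd_conductorNorm_div_congr_of_multiplicative_of_exists_isNewformOf`,
`hasEntireLFunction_rat` through `hasEntireLFunction_rat_of_exists_isNewformOf`, and
`nonempty_modularParametrizationData` through `nonempty_modularParametrizationData_of_exists_isNewformOf`
+ `IsNewformOf.exists_maninConstant_ne_zero_holds`), Greenberg–Stevens (`hGS`). Versus the gen-19
chain of record `forall_bsdp_of_namedFacts_bdd_mtt_heightFree` (14): `hHida` (A77) RETIRED,
`hmod`/`hpar` DERIVED from `hNf`. Class-level residue unchanged: Greenberg's `μ`-conjecture (typed
`X11a.MuAnZeroAt`). No label change. [cite: EmertonPollackWeston2006, p. 2 (H(ρ̄)), Thm. 1, Thm. 3.1.1, Thm. 5.1.3, §2.1]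
[cite: Wan2015, Thm. 4 (pp. 4–5) = Thm. 103 (pp. 91–92)] [cite: SteinWuthrich2013, Thm. 6.1 (p. 20) and §4.2]
[cite: BreuilConradDiamondTaylor2001, Thm. A and p. 845 (2) ⇒ (6)]
[cite: Wuthrich2014, Thm. 3 (p. 382) and Cor. 19 proof (p. 399)] -/
theorem forall_bsdp_of_namedFacts_ofLevel_heightFree
    (hNf : exists_isNewformOf)
    (h311 : thm311_cotorsion_weightK_member_ofLevel) (hT1a : thm1_muAlg_of_weightK_member_ofLevel)
    (hT2 : Wan2015.thm4_rational_weightK_member_of_bdd_ofLevel)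
    (hT1b : thm513_transfer_from_weightK_member_of_bdd_ofLevel)
    (h61 : DeligneSerre1974.thm61_exists_adicGaloisRep) (h326 : Hida2000_thm326_ordinary)
    (hKato : kato_charIdeal_dvd_multiplicative_of_surjective)
    (hJs : thm61_splitMultiplicative) (hJn : thm61_nonsplitMultiplicative)
    (hGZK : rank_eq_analyticRank_of_analyticRank_le_one)
    (hGS : ∀ (W : WeierstrassCurve ℚ) [W.IsElliptic] [W.IsGloballyMinimal] (p : ℕ) [Fact p.Prime],
      greenberg_stevens (W := W) (p := p)) :
    ∀ (W : WeierstrassCurve ℚ) [W.IsElliptic] [W.IsGloballyMinimal] (p : ℕ) [Fact p.Prime],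
      ClassX11a W p → 5 ≤ p → Surj W p → MuAnZeroAt W p → BSDp W p := by
  intro W _ _ p _ hX hp hsurj hμ
  exact bsdp_of_modularity_ofLevel W p hNf h311 hT1a hT2 hT1b h61 h326 hKato hJs hJn hGZK (hGS W p) hp
    hX.2.2.1 hsurj hX.1 hμ

/-- **X11a ∩ {`p ≥ 11`}: `BSD(E,p)` ⇐ 13 NAMED PUBLISHED FACTS + the per-pair certificate, with NO
hypothesis on the image of `ρ̄_{E,p}` and NO Hida-family existence fact** (`Surj` from BDMTV 2019
Thm. 1.2, `hB`, via x11c's `ClassX11a.surj_of_eleven_le`). [cite: BalakrishnanEtAl2019, §1 Thm. 1.2 (arXiv:1711.05846 p. 2)]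
[cite: EmertonPollackWeston2006, Thm. 1, Thm. 3.1.1, Thm. 5.1.3] [cite: BreuilConradDiamondTaylor2001, Thm. A] -/
theorem forall_bsdp_of_namedFacts_ofLevel_heightFree_of_eleven_le
    (hNf : exists_isNewformOf)
    (h311 : thm311_cotorsion_weightK_member_ofLevel) (hT1a : thm1_muAlg_of_weightK_member_ofLevel)
    (hT2 : Wan2015.thm4_rational_weightK_member_of_bdd_ofLevel)
    (hT1b : thm513_transfer_from_weightK_member_of_bdd_ofLevel)
    (h61 : DeligneSerre1974.thm61_exists_adicGaloisRep) (h326 : Hida2000_thm326_ordinary)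
    (hKato : kato_charIdeal_dvd_multiplicative_of_surjective)
    (hJs : thm61_splitMultiplicative) (hJn : thm61_nonsplitMultiplicative)
    (hGZK : rank_eq_analyticRank_of_analyticRank_le_one)
    (hGS : ∀ (W : WeierstrassCurve ℚ) [W.IsElliptic] [W.IsGloballyMinimal] (p : ℕ) [Fact p.Prime],
      greenberg_stevens (W := W) (p := p))
    (hB : thm12_not_le_normalizer_splitCartan) :
    ∀ (W : WeierstrassCurve ℚ) [W.IsElliptic] [W.IsGloballyMinimal] (p : ℕ) [Fact p.Prime],
      ClassX11a W p → 11 ≤ p → MuAnZeroAt W p → BSDp W p := by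
  intro W _ _ p _ hX h11 hμ
  exact forall_bsdp_of_namedFacts_ofLevel_heightFree hNf h311 hT1a hT2 hT1b h61 h326 hKato hJs hJn
    hGZK hGS W p hX (by omega) (ClassX11a.surj_of_eleven_le W p hB hX h11) hμ

/-- **X11a ∩ {`p ≥ 5`, `p ∤ ord_p(Δ_min)`}: `BSD(E,p)` ⇐ the same 12 NAMED PUBLISHED FACTS + the
per-pair certificate, with NO hypothesis on the image of `ρ̄_{E,p}`** (`Surj` from the integer
check, x11c's `ClassX11a.surj_of_not_dvd`). [cite: SerreInventiones1972, §1.12 (Cor. of Prop. 13), §2.4 Prop. 15]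
[cite: EmertonPollackWeston2006, Thm. 1, Thm. 3.1.1, Thm. 5.1.3] [cite: BreuilConradDiamondTaylor2001, Thm. A] -/
theorem forall_bsdp_of_namedFacts_ofLevel_heightFree_of_not_dvd
    (hNf : exists_isNewformOf)
    (h311 : thm311_cotorsion_weightK_member_ofLevel) (hT1a : thm1_muAlg_of_weightK_member_ofLevel)
    (hT2 : Wan2015.thm4_rational_weightK_member_of_bdd_ofLevel)
    (hT1b : thm513_transfer_from_weightK_member_of_bdd_ofLevel)
    (h61 : DeligneSerre1974.thm61_exists_adicGaloisRep) (h326 : Hida2000_thm326_ordinary)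
    (hKato : kato_charIdeal_dvd_multiplicative_of_surjective)
    (hJs : thm61_splitMultiplicative) (hJn : thm61_nonsplitMultiplicative)
    (hGZK : rank_eq_analyticRank_of_analyticRank_le_one)
    (hGS : ∀ (W : WeierstrassCurve ℚ) [W.IsElliptic] [W.IsGloballyMinimal] (p : ℕ) [Fact p.Prime],
      greenberg_stevens (W := W) (p := p)) :
    ∀ (W : WeierstrassCurve ℚ) [W.IsElliptic] [W.IsGloballyMinimal] (p : ℕ) [Fact p.Prime],
      ClassX11a W p → 5 ≤ p → ¬ p ∣ padicValInt p W.minimalDiscriminantInt →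
        MuAnZeroAt W p → BSDp W p := by
  intro W _ _ p _ hX h5 hn hμ
  exact forall_bsdp_of_namedFacts_ofLevel_heightFree hNf h311 hT1a hT2 hT1b h61 h326 hKato hJs hJn
    hGZK hGS W p hX h5 (ClassX11a.surj_of_not_dvd W p hX hn) hμ

/-- **X11a ∩ {`p ≥ 5`, `ρ̄_{E,p}` surjective, `p` NON-split}: `BSD(E,p)` ⇐ 10 NAMED PUBLISHED FACTS +
the per-pair certificate** — EPW Thm 3.1.1 / 1 / 5.1.3 (any level), Wan Thm 4 (any level),
Deligne–Serre 6.1, Hida/Wiles 3.26, Kato–Wuthrich A32, Stein–Wuthrich Thm 6.1 NON-split, GZK,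
modularity (`exists_isNewformOf`); Greenberg–Stevens is vacuous here
(`greenberg_stevens_of_not_split`). No Hida-family existence fact. No label change.
[cite: EmertonPollackWeston2006, Thm. 1, Thm. 3.1.1, Thm. 5.1.3] [cite: Wan2015, Thm. 4]
[cite: SteinWuthrich2013, Thm. 6.1 (p. 20) and §4.2 (p. 15)] [cite: BreuilConradDiamondTaylor2001, Thm. A] -/
theorem forall_bsdp_of_namedFacts_ofLevel_heightFree_of_nonsplit
    (hNf : exists_isNewformOf)
    (h311 : thm311_cotorsion_weightK_member_ofLevel) (hT1a : thm1_muAlg_of_weightK_member_ofLevel)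
    (hT2 : Wan2015.thm4_rational_weightK_member_of_bdd_ofLevel)
    (hT1b : thm513_transfer_from_weightK_member_of_bdd_ofLevel)
    (h61 : DeligneSerre1974.thm61_exists_adicGaloisRep) (h326 : Hida2000_thm326_ordinary)
    (hKato : kato_charIdeal_dvd_multiplicative_of_surjective)
    (hJn : thm61_nonsplitMultiplicative)
    (hGZK : rank_eq_analyticRank_of_analyticRank_le_one) :
    ∀ (W : WeierstrassCurve ℚ) [W.IsElliptic] [W.IsGloballyMinimal] (p : ℕ) [Fact p.Prime],
      ClassX11a W p → 5 ≤ p → Surj W p → ¬ W.HasSplitMultiplicativeReductionAtPrime p →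
        MuAnZeroAt W p → BSDp W p := by
  intro W _ _ p _ hX hp hsurj hns hμ
  haveI : NeZero p := ⟨(Fact.out : p.Prime).ne_zero⟩
  have hmult : W.HasMultiplicativeReductionAtPrime p := hX.2.2.1
  have hmod : hasEntireLFunction_rat := hasEntireLFunction_rat_of_exists_isNewformOf hNf
  have hpar : nonempty_modularParametrizationData :=
    nonempty_modularParametrizationData_of_exists_isNewformOf hNf
      IsNewformOf.exists_maninConstant_ne_zero_holds
  have hGS : greenberg_stevens (W := W) (p := p) :=
    RankZeroHeightFree.greenberg_stevens_of_not_split W p hns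
  have hinv : InvariantsMatchAt W p :=
    invariantsMatchAt_of_invariantsAt_normLam W p
      (invariantsAt_normLam_of_modularity_ofLevel W p hNf h311 hT1a hT2 hT1b h61 h326 hKato hp hmult
        hsurj hμ)
  exact X2.bsdp_of_mazurMainConjectureAt_of_analyticRank_eq_zero_heightFree_nonsplit hJn hGZK hmod
    hpar W p (by omega) hmult hns hX.1
    (mazurMainConjectureAt_of_invariantsMatchAt hKato hmod W p hGS hp hmult hsurj hX.1 hinv)

/-- **X11a ∩ {`p ≥ 5`, `ρ̄_{E,p}` surjective, `p` SPLIT}: `BSD(E,p)` ⇐ 11 NAMED PUBLISHED FACTS +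
the per-pair certificate** — the 10 of the non-split case with Stein–Wuthrich Thm 6.1 SPLIT (`hJs`)
in place of non-split, plus Greenberg–Stevens (`hGS`, needed: the trivial zero). No Hida-family
existence fact. No label change. [cite: EmertonPollackWeston2006, Thm. 1, Thm. 3.1.1, Thm. 5.1.3]
[cite: Wan2015, Thm. 4] [cite: SteinWuthrich2013, Thm. 6.1 (p. 20) and §4.2 (p. 16)]
[cite: Kobayashi2006DocMath, Cor. 4.2 (p. 575)] [cite: BreuilConradDiamondTaylor2001, Thm. A] -/
theorem forall_bsdp_of_namedFacts_ofLevel_heightFree_of_split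
    (hNf : exists_isNewformOf)
    (h311 : thm311_cotorsion_weightK_member_ofLevel) (hT1a : thm1_muAlg_of_weightK_member_ofLevel)
    (hT2 : Wan2015.thm4_rational_weightK_member_of_bdd_ofLevel)
    (hT1b : thm513_transfer_from_weightK_member_of_bdd_ofLevel)
    (h61 : DeligneSerre1974.thm61_exists_adicGaloisRep) (h326 : Hida2000_thm326_ordinary)
    (hKato : kato_charIdeal_dvd_multiplicative_of_surjective)
    (hJs : thm61_splitMultiplicative)
    (hGZK : rank_eq_analyticRank_of_analyticRank_le_one)
    (hGS : ∀ (W : WeierstrassCurve ℚ) [W.IsElliptic] [W.IsGloballyMinimal] (p : ℕ) [Fact p.Prime],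
      greenberg_stevens (W := W) (p := p)) :
    ∀ (W : WeierstrassCurve ℚ) [W.IsElliptic] [W.IsGloballyMinimal] (p : ℕ) [Fact p.Prime],
      ClassX11a W p → 5 ≤ p → Surj W p → W.HasSplitMultiplicativeReductionAtPrime p →
        MuAnZeroAt W p → BSDp W p := by
  intro W _ _ p _ hX hp hsurj hsplit hμ
  haveI : NeZero p := ⟨(Fact.out : p.Prime).ne_zero⟩
  have hmult : W.HasMultiplicativeReductionAtPrime p := hX.2.2.1
  have hmod : hasEntireLFunction_rat := hasEntireLFunction_rat_of_exists_isNewformOf hNf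
  have hpar : nonempty_modularParametrizationData :=
    nonempty_modularParametrizationData_of_exists_isNewformOf hNf
      IsNewformOf.exists_maninConstant_ne_zero_holds
  have hinv : InvariantsMatchAt W p :=
    invariantsMatchAt_of_invariantsAt_normLam W p
      (invariantsAt_normLam_of_modularity_ofLevel W p hNf h311 hT1a hT2 hT1b h61 h326 hKato hp hmult
        hsurj hμ)
  exact X2.bsdp_of_mazurMainConjectureAt_of_analyticRank_eq_zero_heightFree_split hJs hGZK hmod hpar
    W p (hGS W p) (by omega) hsplit hX.1
    (mazurMainConjectureAt_of_invariantsMatchAt hKato hmod W p (hGS W p) hp hmult hsurj hX.1 hinv)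

end Summit.BirchSwinnertonDyer.Rank1Residual.X11a

end
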